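import Literature.Combinatorics.SimpleGraph.TreeRootedCriterionFixedSubtree   -- ★ A-p17: `RootedTree.exists_hull_of_finite`; brings ★ `BakerNorine.exists_fixed_vertex_or_inverted_edge`
import HarnessLib

/-!
# A tree automorphism with a finite invariant set fixes a vertex or inverts an edge (Serre I.6.5; Tits' fixed-point lemma for bounded actions on a tree)

Topic `Combinatorics/SimpleGraph`; namespace `Literature.Combinatorics.SimpleGraph.RootedTree`.  KERNEL mathematics only: theorems, no definition, no `sorry`.
Cell `pub/hodgecm-mathlib`, F0∕P3a, crux H413 = `stmt-HodgeConjecture-24833`, road W′ = «R1LL-WILD» (LEAD T9-25 (b), architect A-p16 (g28)), socket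
«I-5a-ram-WILD» (census `F0/P3a/A-p12/g19/CENSUS-R1LL-wild.A-p12g19.md` §1 (B) row 3; `F0/P3a/F0P3a-p04/g14/CENSUS-END-WILD.F0P3a-p04g14.md` §3 (a)): the
tree-side half of «a bounded element of `U(1,1)(L_w)` lies in a conjugate of `K` or of `K♯`» at a RAMIFIED place of either dyadic type.  Seat F0P3a-p04 (g14).
HONEST LABEL: HC_CM is proved only modulo the printed citations until rung 0 closes; nothing printed is asserted here.

THE MATHEMATICS.  `G` a tree (any vertex type, possibly infinite), `α : G ≃g G`.
* `exists_fixed_or_swap_adj_of_finite_invariant`: if `α` leaves a FINITE NON-EMPTY set `S` of vertices invariant, then `α` fixes a vertex OR inverts an edge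
  (`∃ u v, G.Adj u v ∧ α u = v ∧ α v = u`) — the hull of `S` (★ `exists_hull_of_finite`) is a finite `α`-invariant subtree, on which the finite theorem ★
  `BakerNorine.exists_fixed_vertex_or_inverted_edge` applies (the colour-preserving special case is ★ `exists_fixedPoint_of_finite_invariant`).
* `exists_fixed_or_swap_adj_of_sq_apply_eq`: if `α (α M) = M` for some vertex `M` then `α` fixes a vertex or inverts an edge (`S = {M, α M}`) — the form used
  for an element of `PGL₂(F)` acting on the tree of `SL₂(F)`: its square always has a determinant of even valuation, hence fixes a vertex when the element is bounded.
NOT here: anything about lattices or groups (see ★ `SLTwoTree…`, ★ `UnitaryTwoRamifiedTree…`).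

## References
* [Serre1980Trees] J.-P. Serre, *Trees* (1980), Ch. I §6.5 Prop. 19; §4.3 (inversions).
* [Meier2008] J. Meier, *Groups, Graphs and Trees* (2008), Thm. 3.46, Cor. 3.47.
* [Diestel2010] R. Diestel, *Graph Theory* (2010), Ch. 1 Ex. 16.
-/

set_option autoImplicit false

open SimpleGraph Set
open Literature.Combinatorics.SimpleGraph.BakerNorine

namespace Literature.Combinatorics.SimpleGraph.RootedTree

variable {V : Type*} {G : SimpleGraph V}

/-- **A FINITE INVARIANT SET FORCES A FIXED VERTEX OR AN INVERTED EDGE** (Serre I.6.5 with inversions allowed): for a tree `G`, an automorphism `α` and a finite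
non-empty `α`-invariant set of vertices, `α` fixes a vertex or swaps the two ends of an edge.  Proof: restrict `α` to the hull of the invariant set (a finite
invariant subtree, ★ `exists_hull_of_finite`) and apply the finite theorem ★ `exists_fixed_vertex_or_inverted_edge`.
[cite: Serre1980Trees, I.6.5 Prop. 19 and I.4.3] [cite: Meier2008, Thm. 3.46] [cite: Diestel2010, Ch. 1 Ex. 16] -/
theorem exists_fixed_or_swap_adj_of_finite_invariant (hT : G.IsTree) (α : G ≃g G) {S : Set V} (hS : S.Finite) (hSne : S.Nonempty)
    (hαS : ∀ s ∈ S, α s ∈ S) : (∃ v : V, α v = v) ∨ ∃ u v : V, G.Adj u v ∧ α u = v ∧ α v = u := by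
  classical
  obtain ⟨H, hHf, -, hHc, hHα⟩ := exists_hull_of_finite hT α hS hSne hαS
  haveI : Fintype H := hHf.fintype
  -- `α` restricts to an automorphism of the finite tree induced on the hull (as in ★ `exists_fixedPoint_of_finite_invariant`)
  have hbij : Set.BijOn α H H := (Set.Finite.injOn_iff_bijOn_of_mapsTo hHf (fun v hv => hHα v hv)).1 α.injective.injOn
  let e : H ≃ H := hbij.equiv α
  have he : ∀ v : H, ((e v : H) : V) = α v := fun v => rfl
  let αH : G.induce H ≃g G.induce H :=
    { toEquiv := e
      map_rel_iff' := by
        intro a b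
        change G.Adj ((e a : H) : V) ((e b : H) : V) ↔ G.Adj (a : V) (b : V)
        rw [he, he]
        exact α.map_adj_iff }
  have hcoe : ∀ v : H, ((αH v : H) : V) = α (v : V) := fun v => rfl
  have hTH : (G.induce H).IsTree := (isTree_iff _).2 ⟨hHc, hT.isAcyclic.induce _⟩
  rcases exists_fixed_vertex_or_inverted_edge hTH αH with ⟨v, hv⟩ | ⟨a, b, hab, ha, hb⟩
  · exact Or.inl ⟨v, by rw [← hcoe]; exact congrArg Subtype.val hv⟩
  · refine Or.inr ⟨a, b, ?_, ?_, ?_⟩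
    · exact hab
    · rw [← hcoe]; exact congrArg Subtype.val ha
    · rw [← hcoe]; exact congrArg Subtype.val hb

/-- **If `α²` fixes a vertex then `α` fixes a vertex or inverts an edge** (`S = {M, α M}` is finite, non-empty and invariant).
[cite: Serre1980Trees, I.6.5 Prop. 19 and I.4.3] [cite: Meier2008, Thm. 3.46] -/
theorem exists_fixed_or_swap_adj_of_sq_apply_eq (hT : G.IsTree) (α : G ≃g G) {M : V} (hM : α (α M) = M) :
    (∃ v : V, α v = v) ∨ ∃ u v : V, G.Adj u v ∧ α u = v ∧ α v = u := by
  refine exists_fixed_or_swap_adj_of_finite_invariant hT α (S := {M, α M}) ((Set.finite_singleton _).insert _) ⟨M, Set.mem_insert _ _⟩ ?_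
  rintro s (rfl | hs)
  · exact Set.mem_insert_of_mem _ (Set.mem_singleton _)
  · rw [Set.mem_singleton_iff] at hs
    rw [hs, hM]
    exact Set.mem_insert _ _

end Literature.Combinatorics.SimpleGraph.RootedTree
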